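import Mathlib
import HarnessLib
import Summits.AtomisticToContinuum.Crystallization.Theorems.PricedLinkCensusSoftFourRingsRigRows

/-!
# Soft four-rings, metric half by certified numerics (5): the cell checker

Route `PricedLinkCensus`, sub-problem `Crystallization`, item `SoftFourRings`
(stmt-AtomisticToContinuum-14234).  The per-cell state machine of the certified computation.
A `Model` fixes the labelled bond graph (cuboctahedron / anticuboctahedron), the frame triangle
`r0 r1 r2`, the free point `free` (bonded to `r0`) and the construction steps `(v, a, b, sign)`;
a `Cell` fixes the chart (sign of the `x`-coordinate of the free point), the interval of its
`y`-coordinate, and a stream of instructions with their LP certificates (produced offline, untrusted).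
`runCell` replays the stream: it places points by `place` (both branches, the alternative one
excluded by a Farkas certificate), shrinks boxes by certified bounds (`certUpper`), prunes cells
by Farkas certificates, and finally checks the deviation from a rotated pattern (rational rotation
from an integer quaternion, deviation test in exact integer arithmetic).  Soundness is proved in
the sequel; here only the (computable) definitions.
-/

namespace Summit.AtomisticToContinuum.Crystallization.Theorems

namespace Rig

open Literature.Analysis.ValidatedNumerics.NumericsMP
open scoped Matrix

/-! ### Models, instructions, cells -/

/-- A construction step: place `v` from its bonded neighbours `a, b` on branch `sign`. -/
structure Step where
  /-- the new point -/
  v : Fin 12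
  /-- first parent -/
  a : Fin 12
  /-- second parent -/
  b : Fin 12
  /-- branch (`true` : `+√ρ`) -/
  sign : Bool
  deriving DecidableEq, Repr

/-- A labelled twelve-point model with its construction data. -/
structure Model where
  /-- the bond relation (symmetric) -/
  bond : Fin 12 → Fin 12 → Bool
  /-- frame: `x r0 = e_z`, `x r1` in the `xz`-plane with `x ≥ 0`, `x r2` with `y ≥ 0` -/
  r0 : Fin 12
  /-- frame -/
  r1 : Fin 12
  /-- frame -/
  r2 : Fin 12
  /-- the free point (bonded to `r0`), parametrised by its `y`-coordinate -/
  free : Fin 12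
  /-- construction steps -/
  steps : List Step
  /-- integer pattern table (`fccTab` / `hcpTab`) -/
  tab : Fin 12 → Fin 3 → ℤ
  /-- squared norm of the table vectors (`2` / `18`) -/
  normSq : ℕ

/-- Checker instructions (with their untrusted certificates). -/
inductive Instr : Type
  /-- shrink coordinate `k` of point `v` from above (`up`) or below, by a bound certificate -/
  | bound (v : Fin 12) (k : Fin 3) (up : Bool) (cert : Cert) : Instr
  /-- the cell is infeasible (Farkas certificate) -/
  | prune (terms : List (ℕ × ℕ)) : Instr
  /-- place the next construction step; the alternative branch is excluded by the Farkas
  certificate `terms`, or else refuted by the next `altLen` instructions run on it as a sub-stream -/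
  | place (terms : List (ℕ × ℕ)) (altLen : ℕ) : Instr
  /-- final deviation test against the pattern rotated by the integer quaternion (and reflected in
  `z` if `refl`); `certs` lists, for `i = 0..11`, `k = 0..2`, the upper then the lower bound
  certificate of coordinate `k` of point `i` -/
  | objective (qw qx qy qz : ℤ) (refl : Bool) (certs : List Cert) : Instr

/-- A cell: chart sign of the free point's `x`-coordinate (`true` : `x ≥ 0`), its scaled
`y`-interval `[tlo, thi]` (scale `S`), and the instruction stream. -/
structure Cell where
  /-- chart -/
  xpos : Bool
  /-- scaled lower end of the `y`-interval -/
  tlo : ℤ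
  /-- scaled upper end of the `y`-interval -/
  thi : ℤ
  /-- instructions -/
  instrs : List Instr

/-! ### The frame -/

/-- Box of the point `r1 = (√(1−κ²), 0, κ)`. -/
def boxR1 : IVec := ⟨sqrtI (oneI.sub (kappaI.mul SC kappaI)), zeroI, kappaI⟩

/-- Box of the point `r0 = e_z`. -/
def boxR0 : IVec := ⟨zeroI, zeroI, oneI⟩

/-- Box of the free point on the chart `xpos` with scaled `y`-interval `[tlo, thi]`; `none` if
the radicand `1 − κ² − t²` is certainly negative (no such point exists). -/
def boxFree (xpos : Bool) (tlo thi : ℤ) : Option IVec :=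
  let t : MI := ⟨tlo, thi⟩
  let radic := (oneI.sub (kappaI.mul SC kappaI)).sub (t.mul SC t)
  if radic.hi < 0 then none
  else
    let r := sqrtI radic
    some ⟨clipUnit (if xpos then r else r.neg), t, kappaI⟩

/-- Initial boxes of a cell: `none` = reject, `some none` = vacuous (no configuration),
`some (some bx)` = start. -/
def initBoxes (m : Model) (c : Cell) : Option (Option Boxes) :=
  match place boxR0 boxR1 kappaI kappaI with
  | none => none
  | some (P, _) =>
    match boxFree c.xpos c.tlo c.thi with
    | none => some none
    | some F =>
      some (some fun v =>
        if v = m.free then some F else if v = m.r2 then some P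
        else if v = m.r1 then some boxR1 else if v = m.r0 then some boxR0 else none)

/-! ### One instruction -/

/-- Outcome of an instruction. -/
inductive Outcome : Type
  /-- the cell is done: no configuration survives -/
  | pruned : Outcome
  /-- the deviation test succeeded -/
  | verified : Outcome
  /-- continue with new boxes and remaining steps -/
  | running (bx : Boxes) (steps : List Step) : Outcome
  /-- reject the certificate -/
  | failed : Outcome

/-- The indicator objective `± e_{(v,k)}`. -/
def unitObj (v : Fin 12) (k : Fin 3) (up : Bool) : Fin 12 → Fin 3 → ℤ :=
  fun w l => if w = v ∧ l = k then (if up then 1 else -1) else 0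

/-- Replace coordinate `k` of a box. -/
def IVec.setCoord (B : IVec) (k : Fin 3) (I : MI) : IVec :=
  IVec.ofFn fun l => if l = k then I else B.get l

/-- Apply a bound instruction. -/
def applyBound (m : Model) (bx : Boxes) (st : List Step) (v : Fin 12) (k : Fin 3) (up : Bool)
    (cert : Cert) : Outcome :=
  match bx v with
  | none => Outcome.failed
  | some B =>
    let rows := (rowsOf m.bond bx).toArray
    let U := certUpper bx rows (unitObj v k up) cert
    let I := B.get k
    let C := bx.C v k
    let I' : MI := if up then ⟨I.lo, min I.hi (C + U)⟩ else ⟨max I.lo (C - U), I.hi⟩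
    if I'.hi < I'.lo then Outcome.pruned
    else Outcome.running (Function.update bx v (some (B.setCoord k I'))) st

/-- The boxes of the next construction step: `(v, main, alt, rest)`, or `none` on failure. -/
def placeBoxes (bx : Boxes) (st : List Step) : Option (Fin 12 × IVec × IVec × List Step) :=
  match st with
  | [] => none
  | s :: rest =>
    match bx s.a, bx s.b with
    | some A, some B =>
      match place A B kappaI kappaI with
      | none => none
      | some (P, M) => some (s.v, (if s.sign then P else M), (if s.sign then M else P), rest)
    | _, _ => none

/-! ### The deviation test -/

/-- Integer rotation matrix of the quaternion `(w, x, y, z)` (orthogonal up to the factor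
`n = w² + x² + y² + z²`), with the third column negated if `refl`. -/
def quatMat (w x y z : ℤ) (refl : Bool) : Fin 3 → Fin 3 → ℤ :=
  let s : ℤ := if refl then -1 else 1
  ![![w*w + x*x - y*y - z*z, 2*(x*y - w*z), s * (2*(x*z + w*y))],
    ![2*(x*y + w*z), w*w - x*x + y*y - z*z, s * (2*(y*z - w*x))],
    ![2*(x*z - w*y), 2*(y*z + w*x), s * (w*w - x*x - y*y + z*z)]]

/-- `n = w² + x² + y² + z²`. -/
def quatNorm (w x y z : ℤ) : ℤ := w*w + x*x + y*y + z*z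

/-- Lower enclosure `p ≤ S/√N`. -/
def invSqrtLo (N : ℕ) : ℤ := Int.sqrt ((SC : ℤ) * SC / N)
/-- Upper enclosure `S/√N < q`. -/
def invSqrtHi (N : ℕ) : ℤ := Int.sqrt ((SC : ℤ) * SC / N + 1) + 1

/-- The scaled deviation bound `M_{ik} ≥ n·S·|x_{ik} − u_{ik}|` of one coordinate, from the
certified coordinate window `[α, β]` (scale `S`) and the integer target `w = (M tab_i)_k`. -/
def devCoord (α β n w p q : ℤ) : ℤ :=
  max (max |α * n - w * p| |α * n - w * q|) (max |β * n - w * p| |β * n - w * q|)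

/-- The deviation test at point `i`: `625 · Σ_k M_{ik}² ≤ 36 · (n S)²` (i.e. `≤ (6/25)²`). -/
def devTest (m : Model) (bx : Boxes) (rows : Array Row) (Mq : Fin 3 → Fin 3 → ℤ) (n : ℤ)
    (i : Fin 12) (certs : List Cert) : Bool :=
  let p := invSqrtLo m.normSq
  let q := invSqrtHi m.normSq
  let w : Fin 3 → ℤ := fun k => ∑ l, Mq k l * m.tab i l
  let M : Fin 3 → ℤ := fun k =>
    let cu := certs.getD (2 * k.val) (1, [])
    let cl := certs.getD (2 * k.val + 1) (1, [])
    let U := certUpper bx rows (unitObj i k true) cu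
    let L := certUpper bx rows (unitObj i k false) cl
    devCoord (bx.C i k - L) (bx.C i k + U) n (w k) p q
  decide (625 * ∑ k, M k * M k ≤ 36 * (n * SC) * (n * SC))

/-- Apply the objective instruction: all points placed, all construction steps consumed,
quaternion non-zero, and the deviation test at every point. -/
def applyObjective (m : Model) (bx : Boxes) (st : List Step) (qw qx qy qz : ℤ) (refl : Bool)
    (certs : List Cert) : Outcome :=
  if st.isEmpty && (List.finRange 12).all (fun v => bx.placed v) && decide (0 < quatNorm qw qx qy qz)
  then
    let rows := (rowsOf m.bond bx).toArray
    let Mq := quatMat qw qx qy qz refl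
    let n := quatNorm qw qx qy qz
    if (List.finRange 12).all fun i => devTest m bx rows Mq n i ((certs.drop (6 * i.val)).take 6)
    then Outcome.verified else Outcome.failed
  else Outcome.failed

/-- One non-branching instruction (`place` is handled by `runInstrs`). -/
def stepInstr (m : Model) (bx : Boxes) (st : List Step) : Instr → Outcome
  | Instr.bound v k up cert => applyBound m bx st v k up cert
  | Instr.prune terms =>
      if certInfeasible bx (rowsOf m.bond bx).toArray terms then Outcome.pruned else Outcome.failed
  | Instr.place _ _ => Outcome.failed
  | Instr.objective qw qx qy qz refl certs => applyObjective m bx st qw qx qy qz refl certs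

/-- Replay an instruction stream (with flat nested sub-streams for unrefuted alternative
branches). -/
def runInstrs (m : Model) : Boxes → List Step → List Instr → Bool
  | _, _, [] => false
  | bx, st, Instr.place terms n :: is =>
    match placeBoxes bx st with
    | none => false
    | some (v, main, alt, rest) =>
      let bxAlt : Boxes := Function.update bx v (some alt)
      let altOK := if certInfeasible bxAlt (rowsOf m.bond bxAlt).toArray terms then true
        else runInstrs m bxAlt rest (is.take n)
      altOK && runInstrs m (Function.update bx v (some main)) rest (is.drop n)
  | bx, st, i :: is =>
    match stepInstr m bx st i with
    | Outcome.pruned => true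
    | Outcome.verified => true
    | Outcome.failed => false
    | Outcome.running bx' st' => runInstrs m bx' st' is
termination_by _ _ is => is.length

/-- **The cell checker.** -/
def runCell (m : Model) (c : Cell) : Bool :=
  match initBoxes m c with
  | none => false
  | some none => true
  | some (some bx) => runInstrs m bx m.steps c.instrs

end Rig

end Summit.AtomisticToContinuum.Crystallization.Theorems
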